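import Mathlib
import Summits.CriticalPhenomena.PercolationContinuityZ3.Theorems.PercNearOneGluingNoHeavyLowerTailOrientedAntipodalHall
import Summits.CriticalPhenomena.PercolationContinuityZ3.Theorems.PercNearOneGluingNoHeavyLowerTailThreeFamilyRank

/-!
# The Ω-socket: full linear independence with the one-sided enlargement ⇒ the oriented antipodal Hall count

Helper file for crux `stmt-CriticalPhenomena-4575` (`NoHeavyLowerTail`, route `PercNearOneGluingNoHeavy`),
new-inequality factory seat `prim-ineq-gen-3` (gen 13).  Everything here is PROVED (a reduction).

Setting of `…OrientedAntipodalHall`: `f : Finset α → Lab k` monotone, ground set `S`; a good set is `U ⊆ S`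
with `f U = A`, `f (S \ U) = B`; `D` is any family of subsets of `S` whose complements are not labelled `B`
(e.g. antipodal bads).  The **one-sided enlargement** of the co-goods above `D` is the down-closed family
`G = {F ⊆ S : f F = B, f (S \ F) ≠ B, F ⊆ S \ X for some X ∈ D}`; its members with `f (S \ F) = A` are
exactly the complements of the good sets above `D`, the others form the pseudo-class `Ψ`.

**Theorem (`card_le_card_goods_above_of_indep`).**  If the plain vectors `χ_U = ([F ⊆ U])_{F ∈ G}` of the
complemented members `U = S \ X` (`X ∈ D`) together with those of the pseudo-sets `U ∈ Ψ` are linearly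
independent in `ℚ^G`, then `#D ≤ #{goods above D}`; `exists_injective_good_above_of_indep` is the SDR form
(hypothesis for every sub-family).  This is the socket for CONJECTURE Ω of memo FINDINGS-gen13 (HOME
`run/shared/lean/prim/prim-ineq-gen-3/`): for every monotone `f` and every family of antipodal bads with
opposite-free types the hypothesis holds (0 failures in > 4·10⁴ random labelings on ≤ 9 points with up to
7 petals, exhaustive on 4 points / 3 petals) — which would give the oriented antipodal Hall theorem
(Conjecture O_k) for every number of petals at once.  (prim-ineq-gen-3 gen 13, 2026-08-21.)
-/

namespace Summit.CriticalPhenomena.PercolationContinuityZ3.Theorems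

namespace OrientedAntipodalHall

open Finset Module AntipodalStrongHarris AntipodalStrongHarris.Lab ThreeFamilyRank
open scoped FinsetFamily

variable {α : Type*} [DecidableEq α] {k : ℕ}

/-- **Ω-socket, counting form.**  `f` monotone into `Lab k`, `D` a family of subsets of `S` with
`f (S \ X) ≠ B` for `X ∈ D`; `G` the one-sided enlargement `{F ⊆ S : f F = B, f (S \ F) ≠ B, F ⊆ S \ X for
some X ∈ D}` and `Ψ = {F ∈ G : f (S \ F) ≠ A}` its pseudo-class.  If the plain vectors of the complemented
members `S \ X` (`X ∈ D`) and of the pseudo-sets are linearly independent in `ℚ^G`, then at least `#D` good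
sets lie above members of `D`. -/
theorem card_le_card_goods_above_of_indep (S : Finset α) {f : Finset α → Lab k}
    (D G Ψ : Finset (Finset α)) (hDS : ∀ X ∈ D, X ⊆ S) (hDb : ∀ X ∈ D, f (S \ X) ≠ bot)
    (hG : G = {F ∈ S.powerset | f F = bot ∧ f (S \ F) ≠ bot ∧ ∃ X ∈ D, F ⊆ S \ X})
    (hΨ : Ψ = {F ∈ G | f (S \ F) ≠ top})
    (hind : LinearIndependent ℚ fun U : ↥(D.image (fun X => S \ X) ∪ Ψ) => chi G (U : Finset α)) :
    #D ≤ #{U ∈ S.powerset | f U = top ∧ f (S \ U) = bot ∧ ∃ X ∈ D, X ⊆ U} := by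
  classical
  set M : Finset (Finset α) := D.image (fun X => S \ X) with hM
  set K : Finset (Finset α) := {F ∈ G | f (S \ F) = top} with hK
  -- complementation is injective on subsets of `S`
  have hinjD : Set.InjOn (fun X => S \ X) (D : Set (Finset α)) := by
    intro X₁ hX₁ X₂ hX₂ h
    have h₁ := Finset.sdiff_sdiff_eq_self (hDS X₁ hX₁)
    have h₂ := Finset.sdiff_sdiff_eq_self (hDS X₂ hX₂)
    simp only at h
    rw [← h₁, ← h₂, h]
  have hcardM : #M = #D := card_image_of_injOn hinjD
  -- a member `S \ X` has label `f (S \ X) ≠ B` while every pseudo-set has label `B`: `M` and `Ψ` are disjoint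
  have hdisj : Disjoint M Ψ := by
    rw [Finset.disjoint_left]
    intro U hUM hUΨ
    obtain ⟨X, hX, rfl⟩ := mem_image.mp hUM
    rw [hΨ, mem_filter, hG, mem_filter] at hUΨ
    exact hDb X hX hUΨ.1.2.1
  have hcardU : #(M ∪ Ψ) = #D + #Ψ := by rw [card_union_of_disjoint hdisj, hcardM]
  -- the independent family has at most `dim ℚ^G = #G` members
  have hle : #(M ∪ Ψ) ≤ #G := by
    have h := hind.fintype_card_le_finrank
    rw [finrank_Vec, Fintype.card_coe] at h
    exact h
  -- `#G = #K + #Ψ`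
  have hGsplit : #K + #Ψ = #G := by
    rw [hK, hΨ]
    exact card_filter_add_card_filter_not _
  -- hence `#D ≤ #K`
  have hDK : #D ≤ #K := by omega
  -- `K` injects into the goods above `D` by complementation
  have hKS : ∀ F ∈ K, F ⊆ S := by
    intro F hF
    rw [hK, mem_filter, hG, mem_filter, mem_powerset] at hF
    exact hF.1.1
  have hinjK : Set.InjOn (fun F => S \ F) (K : Set (Finset α)) := by
    intro F₁ hF₁ F₂ hF₂ h
    have h₁ := Finset.sdiff_sdiff_eq_self (hKS F₁ hF₁)
    have h₂ := Finset.sdiff_sdiff_eq_self (hKS F₂ hF₂)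
    simp only at h
    rw [← h₁, ← h₂, h]
  have himg : K.image (fun F => S \ F) ⊆
      {U ∈ S.powerset | f U = top ∧ f (S \ U) = bot ∧ ∃ X ∈ D, X ⊆ U} := by
    intro U hU
    obtain ⟨F, hF, rfl⟩ := mem_image.mp hU
    have hFS := hKS F hF
    rw [hK, mem_filter, hG, mem_filter] at hF
    obtain ⟨⟨-, hFbot, -, X, hX, hFX⟩, hFtop⟩ := hF
    rw [mem_filter, mem_powerset, Finset.sdiff_sdiff_eq_self hFS]
    refine ⟨sdiff_subset, hFtop, hFbot, X, hX, ?_⟩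
    intro a ha
    exact mem_sdiff.mpr ⟨hDS X hX ha, fun haF => (mem_sdiff.mp (hFX haF)).2 ha⟩
  calc #D ≤ #K := hDK
    _ = #(K.image fun F => S \ F) := (card_image_of_injOn hinjK).symm
    _ ≤ #{U ∈ S.powerset | f U = top ∧ f (S \ U) = bot ∧ ∃ X ∈ D, X ⊆ U} := card_le_card himg

/-- **Ω-socket, SDR form.**  If the independence hypothesis of `card_le_card_goods_above_of_indep` holds for
every sub-family of `D`, the members of `D` have DISTINCT good representatives above them. -/
theorem exists_injective_good_above_of_indep (S : Finset α) {f : Finset α → Lab k}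
    (D : Finset (Finset α)) (hDS : ∀ X ∈ D, X ⊆ S) (hDb : ∀ X ∈ D, f (S \ X) ≠ bot)
    (hind : ∀ D' ⊆ D, ∀ G Ψ : Finset (Finset α),
      G = {F ∈ S.powerset | f F = bot ∧ f (S \ F) ≠ bot ∧ ∃ X ∈ D', F ⊆ S \ X} →
      Ψ = {F ∈ G | f (S \ F) ≠ top} →
      LinearIndependent ℚ fun U : ↥(D'.image (fun X => S \ X) ∪ Ψ) => chi G (U : Finset α)) :
    ∃ φ : D → Finset α, Function.Injective φ ∧
      ∀ X : D, (X : Finset α) ⊆ φ X ∧ φ X ⊆ S ∧ f (φ X) = top ∧ f (S \ φ X) = bot := by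
  classical
  let t : D → Finset (Finset α) := fun X =>
    {U ∈ S.powerset | f U = top ∧ f (S \ U) = bot ∧ (X : Finset α) ⊆ U}
  have hHall : ∀ s : Finset D, #s ≤ #(s.biUnion t) := by
    intro s
    set D' : Finset (Finset α) := s.map (Function.Embedding.subtype _) with hD'
    have hD'sub : D' ⊆ D := by
      intro X hX
      obtain ⟨x, -, rfl⟩ := mem_map.mp hX
      exact x.2
    have hcard : #s = #D' := (card_map _).symm
    have hle := card_le_card_goods_above_of_indep S D' _ _ (fun X hX => hDS X (hD'sub hX))
      (fun X hX => hDb X (hD'sub hX)) rfl rfl (hind D' hD'sub _ _ rfl rfl)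
    have hgoods : {U ∈ S.powerset | f U = top ∧ f (S \ U) = bot ∧ ∃ X ∈ D', X ⊆ U} ⊆
        s.biUnion t := by
      intro U hU
      rw [mem_filter, mem_powerset] at hU
      obtain ⟨hUS, hUtop, hUbot, X, hX, hXU⟩ := hU
      obtain ⟨x, hx, rfl⟩ := mem_map.mp hX
      rw [mem_biUnion]
      refine ⟨x, hx, ?_⟩
      simp only [t, mem_filter, mem_powerset]
      exact ⟨hUS, hUtop, hUbot, hXU⟩
    calc #s = #D' := hcard
      _ ≤ #{U ∈ S.powerset | f U = top ∧ f (S \ U) = bot ∧ ∃ X ∈ D', X ⊆ U} := hle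
      _ ≤ #(s.biUnion t) := card_le_card hgoods
  obtain ⟨φ, hφinj, hφ⟩ := (all_card_le_biUnion_card_iff_exists_injective t).mp hHall
  refine ⟨φ, hφinj, fun X => ?_⟩
  have hX := hφ X
  simp only [t, mem_filter, mem_powerset] at hX
  exact ⟨hX.2.2.2, hX.1, hX.2.1, hX.2.2.1⟩

end OrientedAntipodalHall

end Summit.CriticalPhenomena.PercolationContinuityZ3.Theorems
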